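import Literature.Probability.NegativeDependence.NegativeAssociationHierarchy
import HarnessLib

/-!
# Exchangeable measures with ULC rank sequence are CNA (Pemantle, Thm. 2.7; Borcea–Brändén–Liggett, Thm. 3.7 / 6.4)

R. Pemantle, *Towards a theory of negative dependence*, J. Math. Phys. 41 (2000) 1371–1390 [Pemantle2000] (held
`paper:arxiv-math_0404095`), §2.4 (verbatim, p. 9):

> **Definition 2.6.** A finite sequence `{a_k : 0 ≤ k ≤ n}` is said to be Ultra-Log-Concave (ULC) if the nonzero
> terms of the sequence `{a_k / C(n,k)}` form a log-concave sequence and the indices of the nonzero terms form an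
> interval. Convention: From now on, to avoid trivialities, we have included in the definition of log-concavity
> that the indices of the nonzero terms form an interval.
> **Theorem 2.7.** Suppose that `{X_j}` are exchangeable. Then the six conditions CNA+, JNRD+, h-NLC+, CNA, JNRD
> and h-NLC (see Figure 1) are equivalent to Ultra-Log-Concavity of the rank sequence `{a_k}`.

J. Borcea, P. Brändén, T. M. Liggett [BorceaBrandenLiggett2007], §3 **Theorem 3.7 ([P])**: "consider the polynomial
`f = Σ_{k=0}^n a_k e_k(z_1,…,z_n)` where `a_k ≥ 0`. The following are equivalent: (1) `f` … has an ULC rank sequence;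
(2) `f` has either (and then all) of the following five properties: NLC, h-NLC, Rayleigh/h-NLC+, CNA, CNA+", and
§6 **Theorem 6.4** (`g = z_{n+1} Σ a_k e_k + Σ b_k e_k` with `{a_k}, {b_k}` LC, (i), (ii) ⟹ `μ` is CNA), whose printed
proof symmetrizes the test functions: "`f_k, g_k, h_k` are increasing in `k`; e.g., `f_k ≤ f_{k+1}` since `F` is
increasing on `2^S`" and reduces CNA to the nonnegativity of the double sums (cna1)–(cna4).

## What is proved, and how

**`isNegAssoc_pin_card`**: for a `PF₂` (= LC without internal zeros, Pemantle's convention) profile `q` and any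
`I, O ⊆ σ`, the conditioned exchangeable weight `pin I O (S ↦ q_{|S|})` is negatively associated (`IsNegAssoc`,
BBL Def. 2.7); hence **`isCNA_card`** (`S ↦ q_{|S|}` is CNA) and **`Pemantle2000_thm_2_7_CNA`** (exchangeable +
ULC rank sequence ⟹ CNA), the CNA arrow of Thm. 2.7 / Thm. 3.7; with the tree (`ExchangeableRayleigh.lean`:
ULC ⟺ NLC ⟺ h-NLC ⟺ Rayleigh for exchangeable weights) this leaves only CNA+ of Thm. 3.7 (2) outside the tree.

The proof is the symmetrization argument of BBL's Theorem 6.4 in the purely exchangeable case (`a ≡ 0`), which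
is shorter than Pemantle's route through JNRD and Lemma 2.9: for increasing `F` on `2^P` and `G` on `2^Q`
(`P ⊔ Q` the free coordinates) put `f_i = C(m,i)^{-1} Σ_{|A|=i} F(A)` and `g_j` likewise; these are increasing
(`sum_powersetCard_succ_ge`, BBL's "`f_k ≤ f_{k+1}` since `F` is increasing"), and with
`p_{ij} = C(m,i) C(m',j) q_{c+i+j}` the four expectations are `Σ p f g`, `Σ p`, `Σ p f`, `Σ p g`. Log-concavity
of `q` says exactly that the kernel `p` is `RR₂` (`p_{ij} p_{i'j'} ≤ p_{ij'} p_{i'j}` for `i<i'`, `j<j'`), and the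
rearrangement **`rr2_sum_mul_sum_le`** — `(Σ p f g)(Σ p) ≤ (Σ p f)(Σ p g)` for increasing `f, g` and an `RR₂`
kernel, proved by pairing `((i,j),(i',j'))` with `((i,j'),(i',j))` — is the nonnegativity of BBL's (cna2).

## References

* [Pemantle2000] R. Pemantle, Towards a theory of negative dependence, J. Math. Phys. 41 (2000) — §2.4 Def. 2.6,
  Thm. 2.7.
* [BorceaBrandenLiggett2007] J. Borcea, P. Brändén, T. M. Liggett, Negative dependence and the geometry of
  polynomials, J. Amer. Math. Soc. 22 (2009); arXiv:0707.2340 — §3 Thm. 3.7, §6 Thm. 6.4 (proof: symmetrization,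
  (cna1)–(cna4)), §2.1 Def. 2.7.
* [Karlin1968] S. Karlin, Total positivity — Ch. 8 §1 (`PF₂`), `RR₂` kernels.
-/

noncomputable section

open Finset
open Literature.Combinatorics.Sahi2008
open Literature.Probability.Distributions

universe u

namespace Literature.Probability.NegativeDependence

/-! ## §1 Symmetrization: averages over `k`-subsets of an increasing function increase with `k` -/

section Symmetrization

variable {σ : Type u} [DecidableEq σ]

/-- **"`f_k ≤ f_{k+1}` since `F` is increasing"** (double counting the pairs `A ⊂ A'`, `|A'| = |A| + 1`):
`(m - i) Σ_{|A|=i} Φ(A) ≤ (i+1) Σ_{|A'|=i+1} Φ(A')` for `Φ` increasing on `2^P`, `|P| = m`.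
[cite: BorceaBrandenLiggett2007, §6 proof of Thm. 6.4 ("`f_k, g_k, h_k` are increasing in `k`"); proof of
Cor. 6.5 ((cna6))] -/
theorem sum_powersetCard_succ_ge (P : Finset σ) {Φ : Finset σ → ℝ}
    (hΦ : ∀ ⦃A B : Finset σ⦄, A ⊆ B → B ⊆ P → Φ A ≤ Φ B) (i : ℕ) :
    ((P.card - i : ℕ) : ℝ) * ∑ A ∈ P.powersetCard i, Φ A ≤ (i + 1 : ℝ) * ∑ A ∈ P.powersetCard (i + 1), Φ A := by
  -- left side: `Σ_{|A| = i} Σ_{x ∈ P \ A} Φ(A)`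
  have hL : ((P.card - i : ℕ) : ℝ) * ∑ A ∈ P.powersetCard i, Φ A =
      ∑ A ∈ P.powersetCard i, ∑ x ∈ P \ A, Φ A := by
    rw [Finset.mul_sum]
    refine Finset.sum_congr rfl fun A hA => ?_
    rw [Finset.sum_const, nsmul_eq_mul, Finset.card_sdiff_of_subset (Finset.mem_powersetCard.1 hA).1,
      (Finset.mem_powersetCard.1 hA).2]
  -- right side: `Σ_{|A'| = i+1} Σ_{x ∈ A'} Φ(A')`
  have hR : (i + 1 : ℝ) * ∑ A ∈ P.powersetCard (i + 1), Φ A = ∑ A ∈ P.powersetCard (i + 1), ∑ x ∈ A, Φ A := by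
    rw [Finset.mul_sum]
    refine Finset.sum_congr rfl fun A hA => ?_
    rw [Finset.sum_const, nsmul_eq_mul, (Finset.mem_powersetCard.1 hA).2, Nat.cast_add, Nat.cast_one]
  rw [hL, hR]
  -- compare termwise after the reindexing `(A, x) ↦ (A ∪ {x}, x)`
  calc ∑ A ∈ P.powersetCard i, ∑ x ∈ P \ A, Φ A
      ≤ ∑ A ∈ P.powersetCard i, ∑ x ∈ P \ A, Φ (insert x A) :=
        Finset.sum_le_sum fun A hA => Finset.sum_le_sum fun x hx =>
          hΦ (Finset.subset_insert x A) (Finset.insert_subset (Finset.mem_sdiff.1 hx).1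
            (Finset.mem_powersetCard.1 hA).1)
    _ = ∑ A ∈ P.powersetCard (i + 1), ∑ x ∈ A, Φ A := by
        rw [Finset.sum_sigma', Finset.sum_sigma']
        refine Finset.sum_bij' (fun Ax _ => ⟨insert Ax.2 Ax.1, Ax.2⟩) (fun Ax _ => ⟨Ax.1.erase Ax.2, Ax.2⟩)
          (fun Ax hAx => ?_) (fun Ax hAx => ?_) (fun Ax hAx => ?_) (fun Ax hAx => ?_) (fun Ax hAx => ?_)
        · obtain ⟨hA, hx⟩ := Finset.mem_sigma.1 hAx
          obtain ⟨hAP, hcard⟩ := Finset.mem_powersetCard.1 hA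
          obtain ⟨hxP, hxA⟩ := Finset.mem_sdiff.1 hx
          refine Finset.mem_sigma.2 ⟨Finset.mem_powersetCard.2 ⟨Finset.insert_subset hxP hAP, ?_⟩,
            Finset.mem_insert_self _ _⟩
          rw [Finset.card_insert_of_notMem hxA, hcard]
        · obtain ⟨hA, hx⟩ := Finset.mem_sigma.1 hAx
          obtain ⟨hAP, hcard⟩ := Finset.mem_powersetCard.1 hA
          refine Finset.mem_sigma.2 ⟨Finset.mem_powersetCard.2 ⟨(Finset.erase_subset _ _).trans hAP, ?_⟩,
            Finset.mem_sdiff.2 ⟨hAP hx, Finset.notMem_erase _ _⟩⟩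
          rw [Finset.card_erase_of_mem hx, hcard, Nat.add_sub_cancel]
        · obtain ⟨_, hx⟩ := Finset.mem_sigma.1 hAx
          obtain ⟨_, hxA⟩ := Finset.mem_sdiff.1 hx
          simp [Finset.erase_insert hxA]
        · obtain ⟨_, hx⟩ := Finset.mem_sigma.1 hAx
          simp [Finset.insert_erase hx]
        · rfl

/-- Monotonicity on an initial segment from the successor steps. [cite: BorceaBrandenLiggett2007, §6 proof of
Thm. 6.4] -/
theorem mono_of_succ_le {f : ℕ → ℝ} {M : ℕ} (h : ∀ i, i + 1 ≤ M → f i ≤ f (i + 1)) :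
    ∀ i i', i ≤ i' → i' ≤ M → f i ≤ f i' := by
  intro i i' hii' hi'M
  induction i' with
  | zero => rw [Nat.le_zero.1 hii']
  | succ i' ih =>
    rcases Nat.lt_or_eq_of_le hii' with hlt | heq
    · exact (ih (Nat.lt_succ_iff.1 hlt) (by omega)).trans (h i' hi'M)
    · rw [heq]

/-- **The symmetrized averages `f_i = C(m,i)^{-1} Σ_{|A|=i} Φ(A)` increase with `i`** (`0 ≤ i ≤ i' ≤ m`).
[cite: BorceaBrandenLiggett2007, §6 proof of Thm. 6.4 ("`f_k ≤ f_{k+1}` since `F` is increasing on `2^S`")] -/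
theorem symAvg_mono (P : Finset σ) {Φ : Finset σ → ℝ} (hΦ : ∀ ⦃A B : Finset σ⦄, A ⊆ B → B ⊆ P → Φ A ≤ Φ B) :
    ∀ i i', i ≤ i' → i' ≤ P.card →
      (∑ A ∈ P.powersetCard i, Φ A) / (P.card.choose i : ℝ) ≤
        (∑ A ∈ P.powersetCard i', Φ A) / (P.card.choose i' : ℝ) := by
  refine mono_of_succ_le fun i hi => ?_
  have h1 := sum_powersetCard_succ_ge P hΦ i
  have hc : 0 < (P.card.choose i : ℝ) := Nat.cast_pos.2 (Nat.choose_pos (by omega))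
  have hc' : 0 < (P.card.choose (i + 1) : ℝ) := Nat.cast_pos.2 (Nat.choose_pos hi)
  have hid : (P.card.choose (i + 1) : ℝ) * (i + 1) = (P.card.choose i : ℝ) * ((P.card - i : ℕ) : ℝ) := by
    exact_mod_cast Nat.choose_succ_right_eq P.card i
  rw [div_le_div_iff₀ hc hc']
  have hmi : (0 : ℝ) < ((P.card - i : ℕ) : ℝ) := Nat.cast_pos.2 (by omega)
  -- `(Σ_i Φ) C(m,i+1) ≤ (Σ_{i+1} Φ) C(m,i)` ⟸ multiply `h1` by `C(m,i) / (m-i) = C(m,i+1)/(i+1)`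
  have key : (∑ A ∈ P.powersetCard i, Φ A) * (P.card.choose (i + 1) : ℝ) * ((i : ℝ) + 1) ≤
      (∑ A ∈ P.powersetCard (i + 1), Φ A) * (P.card.choose i : ℝ) * ((i : ℝ) + 1) := by
    calc (∑ A ∈ P.powersetCard i, Φ A) * (P.card.choose (i + 1) : ℝ) * ((i : ℝ) + 1)
        = (((P.card - i : ℕ) : ℝ) * ∑ A ∈ P.powersetCard i, Φ A) * (P.card.choose i : ℝ) := by
          rw [mul_assoc, hid]; ring
      _ ≤ ((i + 1 : ℝ) * ∑ A ∈ P.powersetCard (i + 1), Φ A) * (P.card.choose i : ℝ) :=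
          mul_le_mul_of_nonneg_right h1 hc.le
      _ = (∑ A ∈ P.powersetCard (i + 1), Φ A) * (P.card.choose i : ℝ) * ((i : ℝ) + 1) := by ring
  exact le_of_mul_le_mul_right key (by positivity)

end Symmetrization

/-! ## §2 The `RR₂` rearrangement inequality ((cna2) of BBL) -/

section RR2

/-- **`(Σ p f g)(Σ p) ≤ (Σ p f)(Σ p g)` for an `RR₂` kernel `p` on `[0,M] × [0,M']` and increasing `f, g`** —
the nonnegativity of BBL's double sum (cna2) `Σ_{i<j} Σ_{k,ℓ} (f_j - f_i)(g_k - g_ℓ) b_{k+i} b_{ℓ+j} ≥ 0`, by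
pairing `((i,j),(i',j'))` with `((i,j'),(i',j))`. [cite: BorceaBrandenLiggett2007, §6 proof of Thm. 6.4 ((cna1),
(cna2)); Karlin1968, Ch. 8 §1] -/
theorem rr2_sum_mul_sum_le (M M' : ℕ) (p : ℕ → ℕ → ℝ) (f g : ℕ → ℝ)
    (hRR : ∀ i i' j j', i < i' → j < j' → p i j * p i' j' ≤ p i j' * p i' j)
    (hf : ∀ i i', i ≤ i' → i' ≤ M → f i ≤ f i') (hg : ∀ j j', j ≤ j' → j' ≤ M' → g j ≤ g j') :
    (∑ i ∈ range (M + 1), ∑ j ∈ range (M' + 1), p i j * (f i * g j)) *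
        (∑ i ∈ range (M + 1), ∑ j ∈ range (M' + 1), p i j) ≤
      (∑ i ∈ range (M + 1), ∑ j ∈ range (M' + 1), p i j * f i) *
        (∑ i ∈ range (M + 1), ∑ j ∈ range (M' + 1), p i j * g j) := by
  -- the paired term
  set T : ℕ → ℕ → ℕ → ℕ → ℝ := fun i j i' j' =>
    (f i - f i') * (g j' - g j) * (p i j * p i' j' - p i j' * p i' j) with hT
  -- each paired term is nonnegative
  have hTnn : ∀ i ∈ range (M + 1), ∀ j ∈ range (M' + 1), ∀ i' ∈ range (M + 1), ∀ j' ∈ range (M' + 1),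
      0 ≤ T i j i' j' := by
    intro i hi j hj i' hi' j' hj'
    rw [Finset.mem_range] at hi hj hi' hj'
    simp only [hT]
    rcases lt_trichotomy i i' with hii' | rfl | hii'
    · have hf' : f i - f i' ≤ 0 := sub_nonpos.2 (hf i i' hii'.le (by omega))
      rcases lt_trichotomy j j' with hjj' | rfl | hjj'
      · have hg' : 0 ≤ g j' - g j := sub_nonneg.2 (hg j j' hjj'.le (by omega))
        have hΔ : p i j * p i' j' - p i j' * p i' j ≤ 0 := sub_nonpos.2 (hRR i i' j j' hii' hjj')
        exact mul_nonneg_of_nonpos_of_nonpos (mul_nonpos_of_nonpos_of_nonneg hf' hg') hΔ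
      · simp
      · have hg' : g j' - g j ≤ 0 := sub_nonpos.2 (hg j' j hjj'.le (by omega))
        have hΔ : 0 ≤ p i j * p i' j' - p i j' * p i' j := sub_nonneg.2 (by
          have := hRR i i' j' j hii' hjj'; linarith)
        exact mul_nonneg (mul_nonneg_of_nonpos_of_nonpos hf' hg') hΔ
    · simp
    · have hf' : 0 ≤ f i - f i' := sub_nonneg.2 (hf i' i hii'.le (by omega))
      rcases lt_trichotomy j j' with hjj' | rfl | hjj'
      · have hg' : 0 ≤ g j' - g j := sub_nonneg.2 (hg j j' hjj'.le (by omega))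
        have hΔ : 0 ≤ p i j * p i' j' - p i j' * p i' j := sub_nonneg.2 (by
          have := hRR i' i j j' hii' hjj'; linarith)
        exact mul_nonneg (mul_nonneg hf' hg') hΔ
      · simp
      · have hg' : g j' - g j ≤ 0 := sub_nonpos.2 (hg j' j hjj'.le (by omega))
        have hΔ : p i j * p i' j' - p i j' * p i' j ≤ 0 := sub_nonpos.2 (by
          have := hRR i' i j' j hii' hjj'; linarith)
        exact mul_nonneg_of_nonpos_of_nonpos (mul_nonpos_of_nonneg_of_nonpos hf' hg') hΔ
  -- the quadruple sum of the paired terms is `4 (RHS - LHS)`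
  set RM := range (M + 1) with hRM
  set RM' := range (M' + 1) with hRM'
  have hsum : ∑ i ∈ RM, ∑ j ∈ RM', ∑ i' ∈ RM, ∑ j' ∈ RM', T i j i' j' =
      4 * ((∑ i ∈ RM, ∑ j ∈ RM', p i j * f i) * (∑ i ∈ RM, ∑ j ∈ RM', p i j * g j) -
        (∑ i ∈ RM, ∑ j ∈ RM', p i j * (f i * g j)) * (∑ i ∈ RM, ∑ j ∈ RM', p i j)) := by
    -- expand `T` into its two halves; the second half is the first with `j ↔ j'`
    have hsplit : ∀ i j i' j', T i j i' j' =
        (f i - f i') * (g j' - g j) * (p i j * p i' j') + (f i - f i') * (g j - g j') * (p i j' * p i' j) := by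
      intro i j i' j'; simp only [hT]; ring
    have hswap : ∑ i ∈ RM, ∑ j ∈ RM', ∑ i' ∈ RM, ∑ j' ∈ RM', (f i - f i') * (g j - g j') * (p i j' * p i' j) =
        ∑ i ∈ RM, ∑ j ∈ RM', ∑ i' ∈ RM, ∑ j' ∈ RM', (f i - f i') * (g j' - g j) * (p i j * p i' j') := by
      refine Finset.sum_congr rfl fun i _ => ?_
      rw [Finset.sum_comm]
      conv_rhs => rw [Finset.sum_comm]
      refine Finset.sum_congr rfl fun i' _ => ?_
      rw [Finset.sum_comm]
    -- the four products of double sums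
    have e : ∀ i j i' j', (f i - f i') * (g j' - g j) * (p i j * p i' j') =
        (p i j * f i) * (p i' j' * g j') - (p i j * (f i * g j)) * p i' j' -
          p i j * (p i' j' * (f i' * g j')) + (p i j * g j) * (p i' j' * f i') := by intro i j i' j'; ring
    have q1 : ∑ i ∈ RM, ∑ j ∈ RM', ∑ i' ∈ RM, ∑ j' ∈ RM', (p i j * f i) * (p i' j' * g j') =
        (∑ i ∈ RM, ∑ j ∈ RM', p i j * f i) * (∑ i ∈ RM, ∑ j ∈ RM', p i j * g j) := by
      rw [Finset.sum_mul_sum]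
      refine Finset.sum_congr rfl fun i _ => ?_
      rw [Finset.sum_comm]
      exact Finset.sum_congr rfl fun i' _ => (Finset.sum_mul_sum _ _ _ _).symm
    have q2 : ∑ i ∈ RM, ∑ j ∈ RM', ∑ i' ∈ RM, ∑ j' ∈ RM', (p i j * (f i * g j)) * p i' j' =
        (∑ i ∈ RM, ∑ j ∈ RM', p i j * (f i * g j)) * (∑ i ∈ RM, ∑ j ∈ RM', p i j) := by
      rw [Finset.sum_mul_sum]
      refine Finset.sum_congr rfl fun i _ => ?_
      rw [Finset.sum_comm]
      exact Finset.sum_congr rfl fun i' _ => (Finset.sum_mul_sum _ _ _ _).symm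
    have q3 : ∑ i ∈ RM, ∑ j ∈ RM', ∑ i' ∈ RM, ∑ j' ∈ RM', p i j * (p i' j' * (f i' * g j')) =
        (∑ i ∈ RM, ∑ j ∈ RM', p i j) * (∑ i ∈ RM, ∑ j ∈ RM', p i j * (f i * g j)) := by
      rw [Finset.sum_mul_sum]
      refine Finset.sum_congr rfl fun i _ => ?_
      rw [Finset.sum_comm]
      exact Finset.sum_congr rfl fun i' _ => (Finset.sum_mul_sum _ _ _ _).symm
    have q4 : ∑ i ∈ RM, ∑ j ∈ RM', ∑ i' ∈ RM, ∑ j' ∈ RM', (p i j * g j) * (p i' j' * f i') =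
        (∑ i ∈ RM, ∑ j ∈ RM', p i j * g j) * (∑ i ∈ RM, ∑ j ∈ RM', p i j * f i) := by
      rw [Finset.sum_mul_sum]
      refine Finset.sum_congr rfl fun i _ => ?_
      rw [Finset.sum_comm]
      exact Finset.sum_congr rfl fun i' _ => (Finset.sum_mul_sum _ _ _ _).symm
    simp only [hsplit, Finset.sum_add_distrib]
    rw [hswap, ← two_mul]
    simp only [e, Finset.sum_add_distrib, Finset.sum_sub_distrib]
    rw [q1, q2, q3, q4]
    ring
  have hnn : 0 ≤ ∑ i ∈ RM, ∑ j ∈ RM', ∑ i' ∈ RM, ∑ j' ∈ RM', T i j i' j' :=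
    Finset.sum_nonneg fun i hi => Finset.sum_nonneg fun j hj => Finset.sum_nonneg fun i' hi' =>
      Finset.sum_nonneg fun j' hj' => hTnn i hi j hj i' hi' j' hj'
  rw [hsum] at hnn
  linarith

end RR2

/-! ## §3 Conditioned exchangeable weights with a `PF₂` profile are negatively associated -/

section Main

variable {σ : Type u} [Fintype σ] [DecidableEq σ]

/-- Expectations under `pin I O (S ↦ q_{|S|})`, reindexed by the free part `T = S ∖ I ⊆ (I ∪ O)ᶜ`.
[cite: BorceaBrandenLiggett2007, §6 proof of Thm. 6.4 (the symmetrized sums); §2.1 (conditioning)] -/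
theorem ex_pin_card {q : ℕ → ℝ} {I O : Finset σ} (hIO : Disjoint I O) (H : Finset σ → ℝ) :
    ex (pin I O (fun S : Finset σ => q S.card)) H =
      ∑ T ∈ ((I ∪ O)ᶜ).powerset, q (I.card + T.card) * H (I ∪ T) := by
  rw [ex_def]
  have step : ∀ S : Finset σ, pin I O (fun S : Finset σ => q S.card) S * H S =
      if I ⊆ S ∧ Disjoint O S then q S.card * H S else 0 := fun S => by
    rw [pin_apply]; split_ifs <;> simp
  rw [Finset.sum_congr rfl fun S _ => step S, ← Finset.sum_filter]
  refine Finset.sum_bij' (fun S _ => S \ I) (fun T _ => I ∪ T) (fun S hS => ?_) (fun T hT => ?_)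
    (fun S hS => ?_) (fun T hT => ?_) (fun S hS => ?_)
  · obtain ⟨-, hIS, hOS⟩ := Finset.mem_filter.1 hS
    rw [Finset.mem_powerset]
    intro x hx
    rw [Finset.mem_sdiff] at hx
    rw [Finset.mem_compl, Finset.mem_union, not_or]
    exact ⟨hx.2, fun hxO => Finset.disjoint_left.1 hOS hxO hx.1⟩
  · rw [Finset.mem_powerset] at hT
    refine Finset.mem_filter.2 ⟨Finset.mem_univ _, Finset.subset_union_left, Finset.disjoint_left.2 fun x hxO hx => ?_⟩
    rcases Finset.mem_union.1 hx with hxI | hxT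
    · exact Finset.disjoint_left.1 hIO hxI hxO
    · exact (Finset.mem_compl.1 (hT hxT)) (Finset.mem_union_right _ hxO)
  · obtain ⟨-, hIS, -⟩ := Finset.mem_filter.1 hS
    exact Finset.union_sdiff_of_subset hIS
  · rw [Finset.mem_powerset] at hT
    rw [Finset.union_sdiff_left, Finset.sdiff_eq_self_iff_disjoint]
    exact Finset.disjoint_left.2 fun x hxT hxI => (Finset.mem_compl.1 (hT hxT)) (Finset.mem_union_left _ hxI)
  · obtain ⟨-, hIS, -⟩ := Finset.mem_filter.1 hS
    rw [Finset.union_sdiff_of_subset hIS, ← Finset.card_union_of_disjoint Finset.disjoint_sdiff,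
      Finset.union_sdiff_of_subset hIS]

omit [Fintype σ] in
/-- Splitting a sum over the subsets of `P ⊔ Q`. [cite: BorceaBrandenLiggett2007, §6 proof of Thm. 6.4
(`S ∈ 2^{[m]}`, `T` over the complementary coordinates)] -/
theorem sum_powerset_union_of_disjoint {P Q : Finset σ} (hPQ : Disjoint P Q) (φ : Finset σ → ℝ) :
    ∑ T ∈ (P ∪ Q).powerset, φ T = ∑ A ∈ P.powerset, ∑ B ∈ Q.powerset, φ (A ∪ B) := by
  rw [← Finset.sum_product']
  refine Finset.sum_bij' (fun T _ => (T ∩ P, T ∩ Q)) (fun AB _ => AB.1 ∪ AB.2) (fun T hT => ?_)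
    (fun AB hAB => ?_) (fun T hT => ?_) (fun AB hAB => ?_) (fun T hT => ?_)
  · exact Finset.mem_product.2 ⟨Finset.mem_powerset.2 Finset.inter_subset_right,
      Finset.mem_powerset.2 Finset.inter_subset_right⟩
  · obtain ⟨hA, hB⟩ := Finset.mem_product.1 hAB
    rw [Finset.mem_powerset] at hA hB ⊢
    exact Finset.union_subset_union hA hB
  · rw [Finset.mem_powerset] at hT
    dsimp only
    rw [← Finset.inter_union_distrib_left, Finset.inter_eq_left.2 hT]
  · obtain ⟨hA, hB⟩ := Finset.mem_product.1 hAB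
    rw [Finset.mem_powerset] at hA hB
    have h1 : (AB.1 ∪ AB.2) ∩ P = AB.1 := by
      rw [Finset.union_inter_distrib_right, Finset.inter_eq_left.2 hA,
        Finset.disjoint_iff_inter_eq_empty.1 (hPQ.symm.mono_left hB), Finset.union_empty]
    have h2 : (AB.1 ∪ AB.2) ∩ Q = AB.2 := by
      rw [Finset.union_inter_distrib_right, Finset.inter_eq_left.2 hB,
        Finset.disjoint_iff_inter_eq_empty.1 (hPQ.mono_left hA), Finset.empty_union]
    exact Prod.ext h1 h2
  · rw [Finset.mem_powerset] at hT
    dsimp only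
    rw [← Finset.inter_union_distrib_left, Finset.inter_eq_left.2 hT]

omit [Fintype σ] [DecidableEq σ] in
/-- Grouping a sum over subsets by cardinality. [cite: BorceaBrandenLiggett2007, §6 proof of Thm. 6.4] -/
theorem sum_powerset_eq_sum_powersetCard (P : Finset σ) (ψ : Finset σ → ℝ) :
    ∑ A ∈ P.powerset, ψ A = ∑ i ∈ range (P.card + 1), ∑ A ∈ P.powersetCard i, ψ A := by
  rw [Finset.powerset_card_disjiUnion, Finset.sum_disjiUnion]

/-- **The symmetrized form of an expectation** under `pin I O (S ↦ q_{|S|})`: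
`E[H] = Σ_{i,j} q_{c+i+j} Σ_{|A|=i, A ⊆ P} Σ_{|B|=j, B ⊆ Q} H(I ∪ A ∪ B)` for any split `P ⊔ Q` of the free
coordinates. [cite: BorceaBrandenLiggett2007, §6 proof of Thm. 6.4 (the sums over `|S| = k`, `|T| = ℓ`)] -/
theorem ex_pin_card_split {q : ℕ → ℝ} {I O P Q : Finset σ} (hIO : Disjoint I O) (hPQ : Disjoint P Q)
    (hR : P ∪ Q = (I ∪ O)ᶜ) (H : Finset σ → ℝ) :
    ex (pin I O (fun S : Finset σ => q S.card)) H =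
      ∑ i ∈ range (P.card + 1), ∑ j ∈ range (Q.card + 1),
        q (I.card + i + j) * ∑ A ∈ P.powersetCard i, ∑ B ∈ Q.powersetCard j, H (I ∪ (A ∪ B)) := by
  rw [ex_pin_card hIO, ← hR, sum_powerset_union_of_disjoint hPQ, sum_powerset_eq_sum_powersetCard]
  refine Finset.sum_congr rfl fun i _ => ?_
  have inner : ∀ A ∈ P.powersetCard i, ∑ B ∈ Q.powerset, q (I.card + (A ∪ B).card) * H (I ∪ (A ∪ B)) =
      ∑ j ∈ range (Q.card + 1), q (I.card + i + j) * ∑ B ∈ Q.powersetCard j, H (I ∪ (A ∪ B)) := by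
    intro A hA
    obtain ⟨hAP, hAc⟩ := Finset.mem_powersetCard.1 hA
    rw [sum_powerset_eq_sum_powersetCard]
    refine Finset.sum_congr rfl fun j _ => ?_
    rw [Finset.mul_sum]
    refine Finset.sum_congr rfl fun B hB => ?_
    obtain ⟨hBQ, hBc⟩ := Finset.mem_powersetCard.1 hB
    rw [Finset.card_union_of_disjoint (hPQ.mono hAP hBQ), hAc, hBc, Nat.add_assoc]
  rw [Finset.sum_congr rfl inner, Finset.sum_comm]
  refine Finset.sum_congr rfl fun j _ => ?_
  rw [Finset.mul_sum]

/-- **Exchangeable measures with a `PF₂` profile are negatively associated, together with all their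
conditionings** (`pin I O (S ↦ q_{|S|})` is NA; BBL Thm. 6.4 with `a ≡ 0`, Pemantle Thm. 2.7: ULC ⟹ CNA).
[cite: Pemantle2000, §2.4 Thm. 2.7; BorceaBrandenLiggett2007, §3 Thm. 3.7, §6 Thm. 6.4 (proof)] -/
theorem isNegAssoc_pin_card {q : ℕ → ℝ} (hq : IsLogConcaveSeq q) (I O : Finset σ) :
    IsNegAssoc (pin I O (fun S : Finset σ => q S.card)) := by
  intro F G hF hG E₁ E₂ hFE hGE hdisj
  set ν := pin I O (fun S : Finset σ => q S.card) with hν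
  by_cases hIO : Disjoint I O
  swap
  · have hz : ∀ S, ν S = 0 := fun S => by
      rw [hν, pin_apply, if_neg]
      rintro ⟨hIS, hOS⟩
      exact hIO (hOS.symm.mono_left hIS)
    have hex : ∀ H : Finset σ → ℝ, ex ν H = 0 := fun H => Finset.sum_eq_zero fun S _ => by rw [hz S, zero_mul]
    rw [hex, hex, hex, zero_mul, zero_mul]
  -- the free coordinates, split along `E₁`
  set P : Finset σ := (I ∪ O)ᶜ ∩ E₁ with hP
  set Q : Finset σ := (I ∪ O)ᶜ \ E₁ with hQ
  have hPQ : Disjoint P Q := Finset.disjoint_left.2 fun x hxP hxQ =>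
    (Finset.mem_sdiff.1 hxQ).2 (Finset.mem_inter.1 hxP).2
  have hR : P ∪ Q = (I ∪ O)ᶜ := by
    ext x; simp only [hP, hQ, Finset.mem_union, Finset.mem_inter, Finset.mem_sdiff]; tauto
  set m := P.card with hm
  set m' := Q.card with hm'
  set c := I.card with hc
  -- the symmetrized test functions
  set Φ : Finset σ → ℝ := fun A => F (I ∪ A) with hΦ
  set Ψ : Finset σ → ℝ := fun B => G (I ∪ B) with hΨ
  have hΦmono : ∀ ⦃A B : Finset σ⦄, A ⊆ B → B ⊆ P → Φ A ≤ Φ B := fun A B hAB _ =>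
    hF (Finset.union_subset_union (subset_refl I) hAB)
  have hΨmono : ∀ ⦃A B : Finset σ⦄, A ⊆ B → B ⊆ Q → Ψ A ≤ Ψ B := fun A B hAB _ =>
    hG (Finset.union_subset_union (subset_refl I) hAB)
  -- `F`, `G` on `I ∪ A ∪ B`
  have hFval : ∀ A ∈ P.powerset, ∀ B ∈ Q.powerset, F (I ∪ (A ∪ B)) = Φ A := fun A hA B hB => by
    rw [Finset.mem_powerset] at hA hB
    refine hFE _ _ ?_
    rw [← Finset.union_assoc, Finset.union_inter_distrib_right (I ∪ A) B E₁]
    have : B ∩ E₁ = ∅ := Finset.eq_empty_of_forall_notMem fun x hx =>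
      (Finset.mem_sdiff.1 (hB (Finset.mem_inter.1 hx).1)).2 (Finset.mem_inter.1 hx).2
    rw [this, Finset.union_empty]
  have hGval : ∀ A ∈ P.powerset, ∀ B ∈ Q.powerset, G (I ∪ (A ∪ B)) = Ψ B := fun A hA B hB => by
    rw [Finset.mem_powerset] at hA hB
    refine hGE _ _ ?_
    have : A ∩ E₂ = ∅ := Finset.eq_empty_of_forall_notMem fun x hx =>
      Finset.disjoint_left.1 hdisj (Finset.mem_inter.1 (hA (Finset.mem_inter.1 hx).1)).2 (Finset.mem_inter.1 hx).2
    rw [Finset.union_inter_distrib_right, Finset.union_inter_distrib_right, this, Finset.empty_union,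
      ← Finset.union_inter_distrib_right]
  -- the symmetrized sums
  set SΦ : ℕ → ℝ := fun i => ∑ A ∈ P.powersetCard i, Φ A with hSΦ
  set SΨ : ℕ → ℝ := fun j => ∑ B ∈ Q.powersetCard j, Ψ B with hSΨ
  have pcP : ∀ {i} {A}, A ∈ P.powersetCard i → A ∈ P.powerset := fun h =>
    Finset.mem_powerset.2 (Finset.mem_powersetCard.1 h).1
  have pcQ : ∀ {j} {B}, B ∈ Q.powersetCard j → B ∈ Q.powerset := fun h =>
    Finset.mem_powerset.2 (Finset.mem_powersetCard.1 h).1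
  -- the four expectations
  have eFG : ex ν (F * G) = ∑ i ∈ range (m + 1), ∑ j ∈ range (m' + 1), q (c + i + j) * (SΦ i * SΨ j) := by
    rw [hν, ex_pin_card_split hIO hPQ hR]
    refine Finset.sum_congr rfl fun i _ => Finset.sum_congr rfl fun j _ => ?_
    congr 1
    rw [hSΦ, hSΨ, Finset.sum_mul_sum]
    exact Finset.sum_congr rfl fun A hA => Finset.sum_congr rfl fun B hB => by
      rw [Pi.mul_apply, hFval A (pcP hA) B (pcQ hB), hGval A (pcP hA) B (pcQ hB)]
  have eF : ex ν F = ∑ i ∈ range (m + 1), ∑ j ∈ range (m' + 1), q (c + i + j) * (SΦ i * (m'.choose j : ℝ)) := by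
    rw [hν, ex_pin_card_split hIO hPQ hR]
    refine Finset.sum_congr rfl fun i _ => Finset.sum_congr rfl fun j _ => ?_
    congr 1
    rw [hSΦ, Finset.sum_mul]
    exact Finset.sum_congr rfl fun A hA => by
      rw [Finset.sum_congr rfl fun B hB => hFval A (pcP hA) B (pcQ hB), Finset.sum_const, Finset.card_powersetCard,
        nsmul_eq_mul, mul_comm]
  have eG : ex ν G = ∑ i ∈ range (m + 1), ∑ j ∈ range (m' + 1), q (c + i + j) * ((m.choose i : ℝ) * SΨ j) := by
    rw [hν, ex_pin_card_split hIO hPQ hR]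
    refine Finset.sum_congr rfl fun i _ => Finset.sum_congr rfl fun j _ => ?_
    congr 1
    rw [hSΨ, Finset.sum_congr rfl fun A hA => Finset.sum_congr rfl fun B hB => hGval A (pcP hA) B (pcQ hB),
      Finset.sum_const, Finset.card_powersetCard, nsmul_eq_mul]
  have e1 : mass ν = ∑ i ∈ range (m + 1), ∑ j ∈ range (m' + 1), q (c + i + j) * ((m.choose i : ℝ) * (m'.choose j : ℝ)) := by
    rw [show mass ν = ex ν (fun _ => 1) by simp [mass_def, ex_def], hν, ex_pin_card_split hIO hPQ hR]
    refine Finset.sum_congr rfl fun i _ => Finset.sum_congr rfl fun j _ => ?_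
    congr 1
    rw [Finset.sum_const, Finset.card_powersetCard, nsmul_eq_mul, Finset.sum_const, Finset.card_powersetCard,
      nsmul_eq_mul, mul_one]
  -- the kernel `p_{ij} = C(m,i) C(m',j) q_{c+i+j}` and the averages
  set p : ℕ → ℕ → ℝ := fun i j => q (c + i + j) * ((m.choose i : ℝ) * (m'.choose j : ℝ)) with hp
  set f : ℕ → ℝ := fun i => SΦ i / (m.choose i : ℝ) with hf
  set g : ℕ → ℝ := fun j => SΨ j / (m'.choose j : ℝ) with hg
  have hCi : ∀ i ∈ range (m + 1), (m.choose i : ℝ) ≠ 0 := fun i hi =>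
    Nat.cast_ne_zero.2 (Nat.choose_pos (by rw [Finset.mem_range] at hi; omega)).ne'
  have hCj : ∀ j ∈ range (m' + 1), (m'.choose j : ℝ) ≠ 0 := fun j hj =>
    Nat.cast_ne_zero.2 (Nat.choose_pos (by rw [Finset.mem_range] at hj; omega)).ne'
  have rFG : ex ν (F * G) = ∑ i ∈ range (m + 1), ∑ j ∈ range (m' + 1), p i j * (f i * g j) := by
    rw [eFG]
    refine Finset.sum_congr rfl fun i hi => Finset.sum_congr rfl fun j hj => ?_
    simp only [hp, hf, hg]
    field_simp [hCi i hi, hCj j hj]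
  have rF : ex ν F = ∑ i ∈ range (m + 1), ∑ j ∈ range (m' + 1), p i j * f i := by
    rw [eF]
    refine Finset.sum_congr rfl fun i hi => Finset.sum_congr rfl fun j hj => ?_
    simp only [hp, hf]
    field_simp [hCi i hi]
  have rG : ex ν G = ∑ i ∈ range (m + 1), ∑ j ∈ range (m' + 1), p i j * g j := by
    rw [eG]
    refine Finset.sum_congr rfl fun i hi => Finset.sum_congr rfl fun j hj => ?_
    simp only [hp, hg]
    field_simp [hCj j hj]
  have r1 : mass ν = ∑ i ∈ range (m + 1), ∑ j ∈ range (m' + 1), p i j := e1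
  rw [rFG, r1, rF, rG]
  -- the hypotheses of the rearrangement inequality
  refine rr2_sum_mul_sum_le m m' p f g (fun i i' j j' hii' hjj' => ?_)
    (symAvg_mono P hΦmono) (symAvg_mono Q hΨmono)
  have hqq : q (c + i + j) * q (c + i' + j') ≤ q (c + i + j') * q (c + i' + j) :=
    hq.2 (by omega) (by omega) (by omega)
  have hB : 0 ≤ ((m.choose i : ℝ) * (m'.choose j : ℝ)) * ((m.choose i' : ℝ) * (m'.choose j' : ℝ)) := by positivity
  calc p i j * p i' j'
      = (q (c + i + j) * q (c + i' + j')) * (((m.choose i : ℝ) * (m'.choose j : ℝ)) *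
          ((m.choose i' : ℝ) * (m'.choose j' : ℝ))) := by simp only [hp]; ring
    _ ≤ (q (c + i + j') * q (c + i' + j)) * (((m.choose i : ℝ) * (m'.choose j : ℝ)) *
          ((m.choose i' : ℝ) * (m'.choose j' : ℝ))) := mul_le_mul_of_nonneg_right hqq hB
    _ = p i j' * p i' j := by simp only [hp]; ring

/-- **Exchangeable weights with a `PF₂` profile are CNA.** [cite: Pemantle2000, §2.4 Thm. 2.7;
BorceaBrandenLiggett2007, §3 Thm. 3.7] -/
theorem isCNA_card {q : ℕ → ℝ} (hq : IsLogConcaveSeq q) : IsCNA (fun S : Finset σ => q S.card) :=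
  fun I O => isNegAssoc_pin_card hq I O

/-- **Exchangeable weights with a `PF₂` profile are NA.** [cite: Pemantle2000, §2.4 Thm. 2.7;
BorceaBrandenLiggett2007, §3 Thm. 3.7] -/
theorem isNegAssoc_card {q : ℕ → ℝ} (hq : IsLogConcaveSeq q) : IsNegAssoc (fun S : Finset σ => q S.card) :=
  (isCNA_card hq).isNegAssoc

/-- **Pemantle, Thm. 2.7 (ULC ⟹ CNA) / BBL Thm. 3.7 ((1) ⟹ CNA)**: a nonnegative exchangeable weight whose rank
sequence is ULC (equivalently, by the tree's Thm. 2.7 files, which is NLC / h-NLC / Rayleigh) is CNA.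
[cite: Pemantle2000, §2.4 Thm. 2.7; BorceaBrandenLiggett2007, §3 Thm. 3.7] -/
theorem Pemantle2000_thm_2_7_CNA {μ : Finset σ → ℝ} (hex : IsExchangeable μ) (h0 : ∀ S, 0 ≤ μ S)
    (h : IsRayleigh μ) : IsCNA μ := by
  obtain ⟨q, hq, hμ⟩ := (hex.isRayleigh_iff h0).1 h
  rw [show μ = fun S => q S.card from funext hμ]
  exact isCNA_card hq

/-- The same with the NLC hypothesis (Thm. 3.7: NLC ⟹ CNA for exchangeable weights with `μ(∅), μ([n]) > 0`).
[cite: BorceaBrandenLiggett2007, §3 Thm. 3.7; Pemantle2000, §2.4 Thm. 2.7] -/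
theorem IsExchangeable.isCNA_of_isNLC {μ : Finset σ → ℝ} (hex : IsExchangeable μ) (h0 : ∀ S, 0 ≤ μ S)
    (h : IsNLC μ) : IsCNA μ := by
  obtain ⟨q, hq, hμ⟩ := (hex.isNLC_iff h0).1 h
  rw [show μ = fun S => q S.card from funext hμ]
  exact isCNA_card hq

end Main

end Literature.Probability.NegativeDependence

end
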